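import Summits.AtomisticToContinuum.Crystallization.Theorems.ChargedEnergyGapKinkBudgetB
import HarnessLib

/-!
# ChargedEnergyGap · NODE 84 «KinkBudget» (lens-3 g83) — file C of three: (F₂¹⁰) PROVED — THE DEPTH CAP PAST A COLUMN-10 KEY

Line of record `stmt-AtomisticToContinuum-14231` (`Summit.AtomisticToContinuum.ChargedEnergyGap`), route PricedLinkCensus.  Files A/B proved the kink
budget, the table certificates and (F_lo) ⟸ (F₂¹⁰) ∧ (F₃).  THIS FILE proves (F₂¹⁰) `FibreChargeTwoTenQ 80 ρlo ρhi` for every `0 < ρlo`, `ρhi ≤ 1`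
(`fibreChargeTwoTenQ_holds`), so that NODE 84's only residual leaf is (F₃) `FibreChargeThreeMidQ` (three holes, key column `3–6`).

THE ARGUMENT (`kb_depth_cap_fwd`, the discrete free-flight estimate).  Let the key sit at `t₀` with kink `k₀ ≥ 1.8` (column `10`), depth `e₀`, and
let the other marked hole sit at `t' = t₀ + n`, `n ≥ 1` (the case `t' < t₀` is the reflection `s ↦ e(t₀ − s)`).  Lipschitz steps and `k₀ ≥ 1.8` give
the first drop `e₀ − e₁ ≥ 0.8ρ`, so the first squared-depth increment is `−A` with `A = e₀² − e₁² ≥ 0.8ρ(e₀ + e₁)`.  (i) The hole at `t'` rises into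
its site (`e(t') ≥ e(t'−1)`, file A), so by the LEG INEQUALITY `0 ≤ −A + 2ρ²(n − 1)`: the second hole is FAR, `n ≥ 1 + A/(2ρ²)`.  (ii) By the DISCRETE
PARABOLA `e(t')² ≤ e₀² − nA + ρ²n(n − 1) =: e₀² + f(n)` with `f` convex and its vertex below `1 + A/(2ρ²) ≤ n`, so on the WINDOW `n ≤ w = (160 +
2ρ)/ρ` one has `f(n) ≤ f(w) ≤ W² − A w ≤ W² − 0.8 W (e₀ + e₁)` (`W = ρ w = 160 + 2ρ`).  (iii) With `e₁ ≥ e₀ − ρ`: `e(t')² ≤ e₀² − 1.6 W e₀ + 0.8 W ρ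
+ W²`, a convex function of `e₀ ∈ [93.5 + 0.8ρ, 141]` maximal at the shallow end, whence `e(t')² ≤ 10406.25 + 413.6ρ + 3.68ρ² ≤ 10823.6 <
104.5² = 10920.25` for `ρ ≤ 1` (`= 10693.8` at `ρ = 0.691`; margin `226` in `e²`, `1.1` in depth).  (iv) The second hole's min-depth is `≤ e(t') <
104.5`, i.e. table row `≤ 22`, where every entry is `≤ 2.4 ≤ 2.6 = E(10, 2)` (file B, certificate `kbRows22_true`).

Imports ONLY `…ChargedEnergyGapKinkBudgetB` and `HarnessLib`; no `set_option`, no `sorry`, no instance, no notation, no `private`; namespace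
`…Theorems.ChargedEnergyGapChartDial`; new names `kb_depth_cap_fwd`, `kb_second_hole_shallow`, `fibreChargeTwoTenQ_holds`.
-/

noncomputable section

open scoped Classical
open Literature.MathematicalPhysics.StatisticalMechanics Literature.Geometry.DiscreteGeometry
open Summit.AtomisticToContinuum.Crystallization.Theses.PricedLinkCensus
open Summit.AtomisticToContinuum.Crystallization.Theorems.ChargedEnergyGapNegative

namespace Summit.AtomisticToContinuum.Crystallization.Theorems.ChargedEnergyGapChartDial

section TwoTen

variable {ρ : ℝ} {e m : ℤ → ℝ} {S : Finset ℤ} {t₀ : ℤ}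

/-- ★★ **THE DEPTH CAP PAST A STEEP KEY** (forward direction, pure sequence statement): along a non-negative, discretely semiconcave depth
sequence, if at `t₀` the first drop is `≥ 0.8ρ` from a depth `e₀ ≤ 141` with `e₁ ≥ max(93.5, e₀ − ρ)`, then any later site `t' > t₀` inside the window
`ρ(t' − t₀) ≤ 160 + 2ρ` into which the sequence RISES (`e(t'−1) ≤ e(t')`) has depth `e(t') < 104.5` (spacing `0 < ρ ≤ 1`).  Leg inequality ⇒ far;
parabola on the window ⇒ shallow. -/
theorem kb_depth_cap_fwd (hρ : 0 < ρ) (hρ1 : ρ ≤ 1) (he : ∀ t, 0 ≤ e t)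
    (hsc : ∀ t, e (t + 1) ^ 2 + e (t - 1) ^ 2 ≤ 2 * e t ^ 2 + 2 * ρ ^ 2) {t₀ t' : ℤ} (htt : t₀ < t')
    (hwin : ρ * ((t' : ℝ) - t₀) ≤ 160 + 2 * ρ) (hdrop : 4 / 5 * ρ ≤ e t₀ - e (t₀ + 1)) (he1 : 187 / 2 ≤ e (t₀ + 1))
    (he1' : e t₀ - ρ ≤ e (t₀ + 1)) (he0 : e t₀ ≤ 141) (hrise : e (t' - 1) ≤ e t') : e t' < 209 / 2 := by
  obtain ⟨n, hn⟩ : ∃ n : ℕ, (n : ℤ) = t' - t₀ := ⟨(t' - t₀).toNat, Int.toNat_of_nonneg (by omega)⟩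
  have hnR : (n : ℝ) = (t' : ℝ) - t₀ := by exact_mod_cast hn
  -- (ii) the parabola from the key to the second site
  have hpar := kb_parabola hsc t₀ n
  rw [show t₀ + (n : ℤ) = t' by omega] at hpar
  -- (i) the leg inequality: the second site is far
  have hleg := kb_leg' hsc htt
  have hr2 : 0 ≤ e t' ^ 2 - e (t' - 1) ^ 2 := by
    have h := mul_nonneg (sub_nonneg.2 hrise) (by linarith [he (t' - 1)] : 0 ≤ e t' + e (t' - 1))
    linarith [h]
  have hA1 : e t₀ ^ 2 - e (t₀ + 1) ^ 2 ≤ 2 * ρ ^ 2 * ((n : ℝ) - 1) := by rw [hnR]; linarith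
  have hA2 : 4 / 5 * ρ * (e t₀ + e (t₀ + 1)) ≤ e t₀ ^ 2 - e (t₀ + 1) ^ 2 := by
    rw [show e t₀ ^ 2 - e (t₀ + 1) ^ 2 = (e t₀ - e (t₀ + 1)) * (e t₀ + e (t₀ + 1)) by ring]
    exact mul_le_mul_of_nonneg_right hdrop (by linarith)
  -- the window in lattice steps: n ≤ w, ρ w = 160 + 2ρ
  have hwn : ρ * (n : ℝ) ≤ 160 + 2 * ρ := by rw [hnR]; exact hwin
  obtain ⟨w, hρw, hnw, hw0⟩ : ∃ w : ℝ, ρ * w = 160 + 2 * ρ ∧ (n : ℝ) ≤ w ∧ 0 ≤ w := by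
    refine ⟨(160 + 2 * ρ) / ρ, ?_, ?_, ?_⟩
    · field_simp
    · rw [le_div_iff₀ hρ]; linarith
    · positivity
  -- f(n) ≤ f(w): convexity, vertex below n
  have hkey : ρ ^ 2 * (n : ℝ) ^ 2 - (e t₀ ^ 2 - e (t₀ + 1) ^ 2 + ρ ^ 2) * n ≤
      ρ ^ 2 * w ^ 2 - (e t₀ ^ 2 - e (t₀ + 1) ^ 2 + ρ ^ 2) * w := by
    have h1 : 0 ≤ w - n := sub_nonneg.2 hnw
    have h2 : 0 ≤ ρ ^ 2 * (w + n) - (e t₀ ^ 2 - e (t₀ + 1) ^ 2 + ρ ^ 2) := by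
      linarith [hA1, mul_le_mul_of_nonneg_left hnw (sq_nonneg ρ), sq_nonneg ρ]
    linarith [mul_nonneg h1 h2]
  have hpar' : e t' ^ 2 ≤ e t₀ ^ 2 + (ρ ^ 2 * (n : ℝ) ^ 2 - (e t₀ ^ 2 - e (t₀ + 1) ^ 2 + ρ ^ 2) * n) := by
    have : (n : ℝ) * (e (t₀ + 1) ^ 2 - e t₀ ^ 2) + ρ ^ 2 * n * ((n : ℝ) - 1) =
        ρ ^ 2 * (n : ℝ) ^ 2 - (e t₀ ^ 2 - e (t₀ + 1) ^ 2 + ρ ^ 2) * n := by ring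
    linarith [hpar, this]
  have hAw : 4 / 5 * (160 + 2 * ρ) * (e t₀ + e (t₀ + 1)) ≤ (e t₀ ^ 2 - e (t₀ + 1) ^ 2) * w := by
    have h := mul_le_mul_of_nonneg_right hA2 hw0
    calc 4 / 5 * (160 + 2 * ρ) * (e t₀ + e (t₀ + 1)) = 4 / 5 * ρ * (e t₀ + e (t₀ + 1)) * w := by rw [← hρw]; ring
      _ ≤ (e t₀ ^ 2 - e (t₀ + 1) ^ 2) * w := h
  have hρw2 : ρ ^ 2 * w ^ 2 = (160 + 2 * ρ) ^ 2 := by rw [← hρw]; ring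
  have hw0' : 0 ≤ ρ ^ 2 * w := by positivity
  -- (ii) concluded: e(t')² ≤ e₀² + W² − 0.8 W (e₀ + e₁)
  have hmain : e t' ^ 2 ≤ e t₀ ^ 2 + (160 + 2 * ρ) ^ 2 - 4 / 5 * (160 + 2 * ρ) * (e t₀ + e (t₀ + 1)) := by
    linarith [hpar', hkey, hAw, hρw2, hw0']
  -- (iii) e₁ ≥ e₀ − ρ, then the shallow key is the worst
  have hW0 : 0 ≤ 160 + 2 * ρ := by linarith
  have h5 : (160 + 2 * ρ) * (e t₀ - ρ) ≤ (160 + 2 * ρ) * e (t₀ + 1) := mul_le_mul_of_nonneg_left he1' hW0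
  have hmain2 : e t' ^ 2 ≤ e t₀ ^ 2 + (160 + 2 * ρ) ^ 2 - 4 / 5 * (160 + 2 * ρ) * (2 * e t₀ - ρ) := by
    linarith [hmain, h5]
  have hquad : (e t₀ - (187 / 2 + 4 / 5 * ρ)) * (e t₀ - (325 / 2 + 12 / 5 * ρ)) ≤ 0 := by
    apply mul_nonpos_iff.2
    left
    exact ⟨by linarith, by linarith⟩
  have hρ2 : ρ * ρ ≤ ρ * 1 := mul_le_mul_of_nonneg_left hρ1 hρ.le
  have hsq : e t' ^ 2 < (209 / 2) ^ 2 := by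
    linarith [hmain2, hquad, hρ2]
  -- (iv) conclude
  by_contra hge
  rw [not_lt] at hge
  linarith [mul_self_le_mul_self (by norm_num : (0 : ℝ) ≤ 209 / 2) hge, hsq]

/-- ★★ **THE SECOND HOLE OF A COLUMN-10 KEY IS SHALLOW**: in a marked fibre (`R_N = 80`, `0 < ρ ≤ 1`) whose key has kink column `≥ 10`, every other
marked position has min-depth `< 104.5` (both directions: forward by `kb_depth_cap_fwd`, backward by the reflection `s ↦ e(t₀ − s)`). -/
theorem kb_second_hole_shallow (hρ : 0 < ρ) (hρ1 : ρ ≤ 1) (hF : IsMarkedFibre 80 ρ e m S t₀) (hj10 : 10 ≤ capKCol (kink1 ρ e t₀))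
    {u : ℤ} (hu : u ∈ S) (hut : u ≠ t₀) : m u < 209 / 2 := by
  have ht₀ : t₀ ∈ S := hF.2.2.2.2.2.2.1
  have he := hF.1
  have hlip := hF.2.1
  have hsc := hF.2.2.1
  have hm := hF.2.2.2.1
  have hwin := hF.2.2.2.2.1
  have hk0 : 9 / 5 ≤ kink1 ρ e t₀ := by
    have h := kb_le_of_capKCol _ 10 (by norm_num) (by norm_num) hj10
    norm_num at h
    linarith
  obtain ⟨hm0, hm0', -, hm01, hm02, hr0, hd0, -⟩ := kb_hole hρ hF ht₀
  have hk0ρ : 4 / 5 * ρ ≤ (kink1 ρ e t₀ - 1) * ρ := mul_le_mul_of_nonneg_right (by linarith) hρ.le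
  have hdropR : 4 / 5 * ρ ≤ e t₀ - e (t₀ + 1) := hk0ρ.trans hd0
  have hdropL : 4 / 5 * ρ ≤ e t₀ - e (t₀ - 1) := hk0ρ.trans hr0
  have he0 : e t₀ ≤ 141 := by have h := (hm t₀).1; linarith
  have hl0 : e t₀ - ρ ≤ e (t₀ + 1) := by have h := (abs_le.1 (hlip t₀)).1; linarith
  have hl1 : e t₀ - ρ ≤ e (t₀ - 1) := by
    have h := (abs_le.1 (hlip (t₀ - 1))).2
    rw [show t₀ - 1 + 1 = t₀ by ring] at h
    linarith
  obtain ⟨hmu, hru, hdu⟩ := kb_hole_depth hρ hF hu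
  rcases lt_or_gt_of_ne hut with h | h
  · -- the second hole lies before the key: reflect about t₀
    have hw := (hwin t₀ ht₀ u hu).2
    rw [abs_of_nonneg (by rw [sub_nonneg]; exact_mod_cast h.le)] at hw
    have hcap := kb_depth_cap_fwd (e := fun s => e (t₀ - s)) (t₀ := 0) (t' := t₀ - u) hρ hρ1 (fun t => he _)
      (kb_sc_reflect hsc t₀) (by omega) (by push_cast; linarith)
      (by show 4 / 5 * ρ ≤ e (t₀ - 0) - e (t₀ - (0 + 1)); rw [sub_zero, zero_add]; exact hdropL)
      (by show 187 / 2 ≤ e (t₀ - (0 + 1)); rw [zero_add]; linarith)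
      (by show e (t₀ - 0) - ρ ≤ e (t₀ - (0 + 1)); rw [sub_zero, zero_add]; exact hl1)
      (by show e (t₀ - 0) ≤ 141; rw [sub_zero]; exact he0)
      (by show e (t₀ - (t₀ - u - 1)) ≤ e (t₀ - (t₀ - u))
          rw [show t₀ - (t₀ - u - 1) = u + 1 by ring, show t₀ - (t₀ - u) = u by ring]; linarith)
    have hcap' : e (t₀ - (t₀ - u)) < 209 / 2 := hcap
    rw [show t₀ - (t₀ - u) = u by ring] at hcap'
    linarith
  · -- the second hole lies after the key
    have hw := (hwin u hu t₀ ht₀).2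
    rw [abs_of_nonneg (by rw [sub_nonneg]; exact_mod_cast h.le)] at hw
    have hcap := kb_depth_cap_fwd hρ hρ1 he hsc h (by linarith) hdropR (by linarith) hl0 he0 (by linarith)
    linarith

/-- ★★★ **(F₂¹⁰) PROVED**: `FibreChargeTwoTenQ 80 ρlo ρhi` for every `0 < ρlo`, `ρhi ≤ 1` — two marked holes with a key of kink column `10`: the
other hole is shallow (`kb_second_hole_shallow`), hence carries `≤ 2.4 ≤ 2.6 = E(10, 2)`. -/
theorem fibreChargeTwoTenQ_holds {ρlo ρhi : ℝ} (hlo : 0 < ρlo) (hhi : ρhi ≤ 1) : FibreChargeTwoTenQ 80 ρlo ρhi := by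
  intro ρ hρlo hρhi e m S t₀ hF hcol hc2
  have hρ : 0 < ρ := lt_of_lt_of_le hlo hρlo
  have hρ1 : ρ ≤ 1 := hρhi.trans hhi
  have ht₀ : t₀ ∈ S := hF.2.2.2.2.2.2.1
  obtain ⟨u, hu, hut, hsum⟩ := kb_sum_two hc2 ht₀ (fun t => capK (m t) (kink1 ρ e t))
  have hmu := kb_second_hole_shallow hρ hρ1 hF (by omega) hu hut
  have hcu := kb_capK_le_shallow (m u) (kink1 ρ e u) hmu
  rw [hsum, hc2, hcol, kb_lineExcess_ten_two]
  linarith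

end TwoTen

end Summit.AtomisticToContinuum.Crystallization.Theorems.ChargedEnergyGapChartDial
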